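import Summits.ResolutionOfSingularities.ResolutionOfSingularities.Theorems.EquisingularLiftEquisingularLiftNatPushdownScheme
import HarnessLib

/-!
# [OURS · L1 W4.5(b)] EL♮ `EquisingularLiftNat` (stmt-ResolutionOfSingularities-20038), line `sections` —
# helper H-L0a `pushdown_lift_of_nose`, part 5: the global pushdown with hypotheses on a CHOSEN affine cover only

Helper file `--supports stmt-ResolutionOfSingularities-20038` (res-L1-w45b-plan-1 CRUX-PLAN v3.0.1 §1.3 / §4 H-L0a; parts 1–4 =
`…Theorems.EquisingularLiftEquisingularLiftNatPushdown` p500010 and `…NatPushdownScheme` p501971/p502697/p503206). NOT a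
statement of any manuscript; OURS plumbing.

Why this file: `…NatPushdownScheme.isIso_of_isFinite_of_forall_affineOpens` / `…_of_universallyClosed` ask for
injectivity and `ϖ`-surjectivity of `f♯` on EVERY affine open of `Y`. In the nose-case application `Y` is a
scheme-theoretic image `h.image ⊆ ℙ³_O` and Mathlib's `Scheme.Hom.toImage_app_injective` gives injectivity only on the
opens `h.imageι ⁻¹ᵁ U`, `U ⊆ ℙ³_O` affine. The versions below take the hypotheses on an arbitrary family of affine opens
`V i` with `⨆ i, V i = ⊤` (e.g. the preimages of the standard affine charts), nothing else changes:

* `isClosedImmersion_of_isFinite_of_iSup_eq_top` / `isIso_of_isFinite_of_iSup_eq_top` — finite `f`, cover `V`,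
  `ϖ`-surjectivity (+ injectivity) of `f♯` on each `V i`, every non-empty closed set meets `V(ϖ)` `⇒` closed immersion /
  isomorphism;
* `isIso_of_isFinite_of_universallyClosed_of_iSup_eq_top` — the same over a local base `q : Y ⟶ Spec O` universally
  closed, `ϖ = q♯ ϖ₀`, `ϖ₀ ∈ 𝔪_O` (cover hypothesis discharged by `exists_mem_not_mem_basicOpen_of_universallyClosed`).
[folklore]
-/

set_option linter.dupNamespace false -- mandated namespace `Summit.<Summit>.<Problem>` of this single-conjunct summit

noncomputable section

open CategoryTheory AlgebraicGeometry TopologicalSpace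

universe u

namespace Summit.ResolutionOfSingularities.ResolutionOfSingularities.Cruxes.EquisingularLiftNat.Sections

variable {X Y : Scheme.{u}} (f : X ⟶ Y)

/-- **Global pushdown on a chosen affine cover — closed-immersion form.** `f` finite; `V i` affine opens covering `Y`;
`ϖ : Γ(Y, ⊤)`; on each `V i` every section of `X` over `f ⁻¹ (V i)` is `f♯ b + f♯(ϖ|) · c`; every non-empty closed subset
of `Y` has a point where `ϖ` vanishes `⇒` `f` is a closed immersion. [folklore] -/
theorem isClosedImmersion_of_isFinite_of_iSup_eq_top [IsFinite f] {ι : Type*} (V : ι → Y.Opens)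
    (hV : ∀ i, IsAffineOpen (V i)) (hcov : ⨆ i, V i = ⊤) (ϖ : Γ(Y, ⊤))
    (hsurj : ∀ i, ∀ a : Γ(X, f ⁻¹ᵁ V i), ∃ b : Γ(Y, V i), ∃ c : Γ(X, f ⁻¹ᵁ V i),
      a = f.app (V i) b + f.app (V i) (Y.presheaf.map (homOfLE le_top).op ϖ) * c)
    (hspec : ∀ Z : Set Y, IsClosed Z → Z.Nonempty → ∃ y ∈ Z, y ∉ Y.basicOpen ϖ) :
    IsClosedImmersion f := by
  have key : ∀ i, ∃ r : Γ(Y, V i),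
      r - 1 ∈ Ideal.span {Y.presheaf.map (homOfLE le_top).op ϖ} ∧ IsClosedImmersion (f ∣_ Y.basicOpen r) := by
    intro i
    letI : Algebra Γ(Y, V i) Γ(X, f ⁻¹ᵁ V i) := (f.app (V i)).hom.toAlgebra
    exact exists_isClosedImmersion_morphismRestrict_basicOpen f (hV i) _
      (surjective_mod_span_singleton_of_forall_exists (B := Γ(Y, V i)) (A := Γ(X, f ⁻¹ᵁ V i)) _ (hsurj i))
  choose r hr1 hr using key
  refine IsZariskiLocalAtTarget.of_iSup_eq_top (fun i => Y.basicOpen (r i)) ?_ hr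
  refine top_le_iff.mp fun y _ => ?_
  by_contra hy
  set W : Y.Opens := ⨆ i, Y.basicOpen (r i)
  obtain ⟨y', hy'Z, hy'ϖ⟩ := hspec ((W : Set Y)ᶜ) W.isOpen.isClosed_compl ⟨y, hy⟩
  obtain ⟨i, hi⟩ := Opens.mem_iSup.mp (show y' ∈ ⨆ i, V i by rw [hcov]; trivial)
  exact hy'Z (Opens.mem_iSup.mpr ⟨i, mem_basicOpen_of_sub_one_mem _ _ (hr1 i) y' hi
    (not_mem_basicOpen_of_mem_span_res ϖ y' hy'ϖ)⟩)

/-- **Global pushdown on a chosen affine cover — isomorphism form.** As above plus injectivity of `f♯` on each `V i`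
`⇒` `f` is an isomorphism. [folklore] -/
theorem isIso_of_isFinite_of_iSup_eq_top [IsFinite f] {ι : Type*} (V : ι → Y.Opens)
    (hV : ∀ i, IsAffineOpen (V i)) (hcov : ⨆ i, V i = ⊤) (ϖ : Γ(Y, ⊤))
    (hinj : ∀ i, Function.Injective (f.app (V i)).hom)
    (hsurj : ∀ i, ∀ a : Γ(X, f ⁻¹ᵁ V i), ∃ b : Γ(Y, V i), ∃ c : Γ(X, f ⁻¹ᵁ V i),
      a = f.app (V i) b + f.app (V i) (Y.presheaf.map (homOfLE le_top).op ϖ) * c)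
    (hspec : ∀ Z : Set Y, IsClosed Z → Z.Nonempty → ∃ y ∈ Z, y ∉ Y.basicOpen ϖ) :
    IsIso f := by
  have key : ∀ i, ∃ r : Γ(Y, V i),
      r - 1 ∈ Ideal.span {Y.presheaf.map (homOfLE le_top).op ϖ} ∧ IsIso (f ∣_ Y.basicOpen r) := by
    intro i
    letI : Algebra Γ(Y, V i) Γ(X, f ⁻¹ᵁ V i) := (f.app (V i)).hom.toAlgebra
    exact exists_isIso_morphismRestrict_basicOpen f (hV i) _ (hinj i)
      (surjective_mod_span_singleton_of_forall_exists (B := Γ(Y, V i)) (A := Γ(X, f ⁻¹ᵁ V i)) _ (hsurj i))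
  choose r hr1 hr using key
  refine (MorphismProperty.isomorphisms.iff _).mp <|
    IsZariskiLocalAtTarget.of_iSup_eq_top (P := MorphismProperty.isomorphisms Scheme)
      (fun i => Y.basicOpen (r i)) ?_ fun i => (MorphismProperty.isomorphisms.iff _).mpr (hr i)
  refine top_le_iff.mp fun y _ => ?_
  by_contra hy
  set W : Y.Opens := ⨆ i, Y.basicOpen (r i)
  obtain ⟨y', hy'Z, hy'ϖ⟩ := hspec ((W : Set Y)ᶜ) W.isOpen.isClosed_compl ⟨y, hy⟩
  obtain ⟨i, hi⟩ := Opens.mem_iSup.mp (show y' ∈ ⨆ i, V i by rw [hcov]; trivial)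
  exact hy'Z (Opens.mem_iSup.mpr ⟨i, mem_basicOpen_of_sub_one_mem _ _ (hr1 i) y' hi
    (not_mem_basicOpen_of_mem_span_res ϖ y' hy'ϖ)⟩)

/-- **Global pushdown on a chosen affine cover, over a local base** (the form the nose case (N) consumes with
`V i := h.imageι ⁻¹ᵁ (standard affine charts of ℙ³_O)`): `q : Y ⟶ Spec O` universally closed, `O` local, `ϖ₀ ∈ 𝔪_O`;
`f` finite, injective and `(q♯ϖ₀)`-surjective on the `V i` `⇒` `f` is an isomorphism. [folklore] -/
theorem isIso_of_isFinite_of_universallyClosed_of_iSup_eq_top {O : CommRingCat.{u}} [IsLocalRing O]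
    (q : Y ⟶ Spec O) [UniversallyClosed q] (ϖ₀ : O) (hϖ₀ : ϖ₀ ∈ IsLocalRing.maximalIdeal O) [IsFinite f]
    {ι : Type*} (V : ι → Y.Opens) (hV : ∀ i, IsAffineOpen (V i)) (hcov : ⨆ i, V i = ⊤)
    (hinj : ∀ i, Function.Injective (f.app (V i)).hom)
    (hsurj : ∀ i, ∀ a : Γ(X, f ⁻¹ᵁ V i), ∃ b : Γ(Y, V i), ∃ c : Γ(X, f ⁻¹ᵁ V i),
      a = f.app (V i) b +
        f.app (V i) (Y.presheaf.map (homOfLE le_top).op (q.appTop ((Scheme.ΓSpecIso O).inv ϖ₀))) * c) :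
    IsIso f :=
  isIso_of_isFinite_of_iSup_eq_top f V hV hcov _ hinj hsurj
    (exists_mem_not_mem_basicOpen_of_universallyClosed q ϖ₀ hϖ₀)

end Summit.ResolutionOfSingularities.ResolutionOfSingularities.Cruxes.EquisingularLiftNat.Sections
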